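import Summits.ValiantsHypothesis.ValiantsHypothesis.Theorems.RigidityForcesSymmetryGrenetFirstOrderRankRigidDesignWord

/-!
# Route RigidityForcesSymmetry — `GrenetFirstOrderRankRigid` (item stmt-ValiantsHypothesis-21029),
line `grenet_gauge`: stub `stub_linearRigid`, step 5 (block I=) — the telescoping identity for the
both-type entries (D-y)

For the crux line `Cruxes/GrenetFirstOrderRankRigid/Lines/grenet_gauge.lean` (blueprint
`Lines/grenet_gauge-stub_linearRigid-PROOF.md`, §5, block I=; interface `…-BLOCKS.md`, deliverable (D-y)).
`grenet_blockIeq_y`: a both-type non-arc entry (row `S`, column `T'`, variable `(f, |S|)`, `f ∉ S`,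
`f ∈ T'`) is minus a genuine tail witness of `(S, T' - f)` minus a genuine head witness of `(S + f, T')`:
the design word `[S - α] α f β [T'ᶜ - β]` has the window `{s, s+1, s+2}` and the window identity
(`grenet_window_identity'`) is the sum of the three entries.  Companion of `…BlockIeq` ((D-PQ) for the
equal-size pairs).  No new definitions.  VP ≠ VNP is not moved by this file.
-/

noncomputable section

open MvPolynomial Matrix Finset

namespace Summit.ValiantsHypothesis.Theorems.RigidityForcesSymmetry.GrenetGauge

open Literature.Computability.AlgebraicComplexity

/-! ### Block I=: (D-PQ) — tail and head witnesses of an equal-size pair are opposite -/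

section BlockIeq

variable {k : Type*} [CommRing k] [IsDomain k] {n N : ℕ} (e : Finset (Fin n) ≃ Fin (N + 1))

set_option maxHeartbeats 800000 in
/-- **(D-y) for the both-type non-arc entries (block I= of the blueprint).**  Let `Σ_v x_v A'_v` be a
homogeneous direction Zariski-tangent at Grenet's pencil and let `(i, j, v)` be an entry that is both
a tail and a head entry but not an arc entry: `v = (f, |S|)`, `S = R i ∌ f`, `T' = C j ∋ f`,
`|T'| = |S| + 1`.  Given a genuine tail witness `(i₃, j₃, v₃)` of the pair `(S, T' - f)`
(`R i₃ + v₃.1 = S`, `C j₃ = T' - f`) and a genuine head witness `(i₄, j₄, v₄)` of the pair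
`(S + f, T')` (`R i₄ = S + f`, `C j₄ - v₄.1 = T'`), we have
`A'_v i j = -(A'_{v₃} i₃ j₃) - (A'_{v₄} i₄ j₄)`: the design word `[S - α] α f β [T'ᶜ - β]` has exactly
the three valid splits `s, s+1, s+2` (`s = |S| - 1`) whose entries are these three, and the window
identity is their sum (it telescopes to the gauge values). [cite: Grenet2011, Thm. 1] -/
theorem grenet_blockIeq_y (hn : n ≠ 0) (hN : 2 ^ n = N + 1)
    (A' : Fin n × Fin n → Matrix (Fin N) (Fin N) k)
    (htr : ((Grenet.repr k n e).adjugate * ∑ v, (X v : MvPolynomial (Fin n × Fin n) k) • (A' v).map C).trace = 0)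
    (i j : Fin N) (v : Fin n × Fin n)
    (hy1 : v.1 ∉ e.symm ((e univ).succAbove i)) (hy2 : (v.2 : ℕ) = (e.symm ((e univ).succAbove i)).card)
    (hy3 : v.1 ∈ e.symm ((e ∅).succAbove j)) (hy4 : (e.symm ((e ∅).succAbove j)).card = (v.2 : ℕ) + 1)
    (i₃ j₃ : Fin N) (v₃ : Fin n × Fin n)
    (h3t1 : v₃.1 ∉ e.symm ((e univ).succAbove i₃)) (h3t2 : (v₃.2 : ℕ) = (e.symm ((e univ).succAbove i₃)).card)
    (h3g : ¬ (v₃.1 ∈ e.symm ((e ∅).succAbove j₃) ∧ (e.symm ((e ∅).succAbove j₃)).card = (v₃.2 : ℕ) + 1))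
    (h3U : insert v₃.1 (e.symm ((e univ).succAbove i₃)) = e.symm ((e univ).succAbove i))
    (h3T : e.symm ((e ∅).succAbove j₃) = (e.symm ((e ∅).succAbove j)).erase v.1)
    (i₄ j₄ : Fin N) (v₄ : Fin n × Fin n)
    (h4h1 : v₄.1 ∈ e.symm ((e ∅).succAbove j₄)) (h4h2 : (e.symm ((e ∅).succAbove j₄)).card = (v₄.2 : ℕ) + 1)
    (h4g : ¬ (v₄.1 ∉ e.symm ((e univ).succAbove i₄) ∧ (v₄.2 : ℕ) = (e.symm ((e univ).succAbove i₄)).card))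
    (h4U : e.symm ((e univ).succAbove i₄) = insert v.1 (e.symm ((e univ).succAbove i)))
    (h4T : (e.symm ((e ∅).succAbove j₄)).erase v₄.1 = e.symm ((e ∅).succAbove j)) :
    A' v i j = -A' v₃ i₃ j₃ - A' v₄ i₄ j₄ := by
  classical
  -- notation
  set Xs := e.symm ((e univ).succAbove i₃) with hXs
  set S := e.symm ((e univ).succAbove i) with hSdef
  set T' := e.symm ((e ∅).succAbove j) with hT'def
  set α := v₃.1 with hα
  set f := v.1 with hf
  set β := v₄.1 with hβ
  set s : ℕ := (v₃.2 : ℕ) with hs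
  have hXcard : Xs.card = s := h3t2.symm
  have hScard : S.card = s + 1 := by rw [← h3U, Finset.card_insert_of_notMem h3t1, hXcard]
  have hv2 : (v.2 : ℕ) = s + 1 := by rw [hy2, hScard]
  have hT'card : T'.card = s + 2 := by rw [hy4, hv2]
  have hCj₃ : e.symm ((e ∅).succAbove j₃) = T'.erase f := h3T
  have hCj₄ : e.symm ((e ∅).succAbove j₄) = insert β T' := by rw [← h4T, Finset.insert_erase h4h1]
  have hβT' : β ∉ T' := by rw [← h4T]; exact Finset.notMem_erase β _
  have hv₄2 : (v₄.2 : ℕ) = s + 2 := by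
    have := h4h2; rw [hCj₄, Finset.card_insert_of_notMem hβT', hT'card] at this; omega
  have hβU : β ∈ insert f S := by
    by_contra h
    refine h4g ⟨by rw [h4U]; exact h, ?_⟩
    rw [h4U, Finset.card_insert_of_notMem hy1, hScard, hv₄2]
  have hαS : α ∈ S := by rw [← h3U]; exact Finset.mem_insert_self _ _
  have hαR' : α ∉ T'.erase f := fun h => h3g ⟨by rw [hCj₃]; exact h, by
    rw [hCj₃, Finset.card_erase_of_mem hy3, hT'card]; omega⟩
  have hαf : α ≠ f := fun h => hy1 (h ▸ hαS)
  have hαT' : α ∉ T' := fun h => hαR' (Finset.mem_erase.mpr ⟨hαf, h⟩)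
  have hfβ : f ≠ β := fun h => hβT' (h ▸ hy3)
  have hβS : β ∈ S := (Finset.mem_insert.mp hβU).resolve_left (Ne.symm hfβ)
  have hfX : f ∉ Xs := fun h => hy1 (by rw [← h3U]; exact Finset.mem_insert_of_mem h)
  have hsn : s + 3 ≤ n := by
    have h1 : (insert β T').card ≤ n := (Finset.card_le_univ _).trans_eq (Fintype.card_fin n)
    rw [Finset.card_insert_of_notMem hβT', hT'card] at h1; omega
  set Y := T'ᶜ.erase β with hYdef
  have hβTc : β ∈ T'ᶜ := Finset.mem_compl.mpr hβT'
  have hYcard : Y.card = n - s - 3 := by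
    rw [hYdef, Finset.card_erase_of_mem hβTc, Finset.card_compl, hT'card, Fintype.card_fin]; omega
  -- the design word `[Xs] α f β [Y]`
  set mid : Fin 3 → Fin n := ![α, f, β] with hmid
  set r : Fin n → Fin n := fun c =>
    if h : (c : ℕ) < s then ((Xs.orderIsoOfFin hXcard ⟨c, h⟩ : Xs) : Fin n)
    else if h' : (c : ℕ) - s < 3 then mid ⟨(c : ℕ) - s, h'⟩
    else ((Y.orderIsoOfFin hYcard ⟨(c : ℕ) - s - 3, by have := c.isLt; omega⟩ : Y) : Fin n) with hr_def
  have hr : ∀ c : Fin n, r c =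
      if h : (c : ℕ) < s then ((Xs.orderIsoOfFin hXcard ⟨c, h⟩ : Xs) : Fin n)
      else if h' : (c : ℕ) - s < 3 then mid ⟨(c : ℕ) - s, h'⟩
      else ((Y.orderIsoOfFin hYcard ⟨(c : ℕ) - s - 3, by have := c.isLt; omega⟩ : Y) : Fin n) := fun c => rfl
  have hmid0 : mid 0 = α := rfl
  have hmid1 : mid 1 = f := rfl
  have hmid2 : mid 2 = β := rfl
  have hrs : r ⟨s, by omega⟩ = α := by
    have h0 := designWord_apply_add Xs Y hXcard hYcard hsn mid r hr 0
    rw [hmid0] at h0; exact h0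
  have hrs1 : r ⟨s + 1, by omega⟩ = f := by
    have h1 := designWord_apply_add Xs Y hXcard hYcard hsn mid r hr 1
    rw [hmid1] at h1; exact h1
  have hrs2 : r ⟨s + 2, by omega⟩ = β := by
    have h2 := designWord_apply_add Xs Y hXcard hYcard hsn mid r hr 2
    rw [hmid2] at h2; exact h2
  -- images of the middle block
  have hmid_lt0 : (univ.filter fun i : Fin 3 => (i : ℕ) < 0).image mid = ∅ := by
    rw [Finset.image_eq_empty]; exact Finset.filter_false_of_mem fun i _ => Nat.not_lt_zero _
  have hf1 : (univ.filter fun i : Fin 3 => (i : ℕ) < 1) = {0} := by ext i; fin_cases i <;> simp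
  have hmid_lt1 : (univ.filter fun i : Fin 3 => (i : ℕ) < 1).image mid = {α} := by
    rw [hf1, Finset.image_singleton, hmid0]
  have hf2 : (univ.filter fun i : Fin 3 => (i : ℕ) < 2) = {0, 1} := by ext i; fin_cases i <;> simp
  have hmid_lt2 : (univ.filter fun i : Fin 3 => (i : ℕ) < 2).image mid = {α, f} := by
    rw [hf2, Finset.image_insert, Finset.image_singleton, hmid0, hmid1]
  have hg0 : (univ.filter fun i : Fin 3 => 0 < (i : ℕ)) = {1, 2} := by ext i; fin_cases i <;> simp
  have hmid_gt0 : (univ.filter fun i : Fin 3 => 0 < (i : ℕ)).image mid = {f, β} := by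
    rw [hg0, Finset.image_insert, Finset.image_singleton, hmid1, hmid2]
  have hg1 : (univ.filter fun i : Fin 3 => 1 < (i : ℕ)) = {2} := by ext i; fin_cases i <;> simp
  have hmid_gt1 : (univ.filter fun i : Fin 3 => 1 < (i : ℕ)).image mid = {β} := by
    rw [hg1, Finset.image_singleton, hmid2]
  have hmid_gt2 : (univ.filter fun i : Fin 3 => 2 < (i : ℕ)).image mid = ∅ := by
    rw [Finset.image_eq_empty]; exact Finset.filter_false_of_mem fun i _ => by have := i.isLt; omega
  have hpre0 : (univ.filter fun c : Fin n => (c : ℕ) < s).image r = Xs := by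
    have := designWord_pre Xs Y hXcard hYcard hsn mid r hr 0 (by omega)
    rw [Nat.add_zero, hmid_lt0, Finset.union_empty] at this; exact this
  have hpre1 : (univ.filter fun c : Fin n => (c : ℕ) < s + 1).image r = S := by
    rw [designWord_pre Xs Y hXcard hYcard hsn mid r hr 1 (by omega), hmid_lt1, Finset.union_comm,
      ← Finset.insert_eq, h3U]
  have hpre2 : (univ.filter fun c : Fin n => (c : ℕ) < s + 2).image r = insert f S := by
    rw [designWord_pre Xs Y hXcard hYcard hsn mid r hr 2 (by omega), hmid_lt2, ← h3U, Finset.insert_eq f,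
      Finset.insert_eq α Xs, Finset.insert_eq α ({f} : Finset (Fin n))]
    ac_rfl
  have hsuf0 : (univ.filter fun c : Fin n => s < (c : ℕ)).image r = (T'.erase f)ᶜ := by
    have := designWord_suf Xs Y hXcard hYcard hsn mid r hr 0 (by omega)
    rw [Nat.add_zero, hmid_gt0] at this
    rw [this, hYdef]
    ext x
    simp only [Finset.mem_union, Finset.mem_erase, Finset.mem_compl, Finset.mem_insert, Finset.mem_singleton,
      ne_eq, not_and]
    constructor
    · rintro (⟨h1, h2⟩ | h | h)
      · exact fun _ => h2
      · exact fun h' => absurd h h'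
      · exact fun _ => h ▸ hβT'
    · intro h
      by_cases hxf : x = f
      · exact Or.inr (Or.inl hxf)
      · by_cases hxβ : x = β
        · exact Or.inr (Or.inr hxβ)
        · exact Or.inl ⟨hxβ, h hxf⟩
  have hsuf1 : (univ.filter fun c : Fin n => s + 1 < (c : ℕ)).image r = T'ᶜ := by
    rw [designWord_suf Xs Y hXcard hYcard hsn mid r hr 1 (by omega), hmid_gt1, hYdef, Finset.union_comm,
      ← Finset.insert_eq, Finset.insert_erase hβTc]
  have hsuf2 : (univ.filter fun c : Fin n => s + 2 < (c : ℕ)).image r = Y := by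
    rw [designWord_suf Xs Y hXcard hYcard hsn mid r hr 2 (by omega), hmid_gt2, Finset.union_empty]
  have hYc : Yᶜ = insert β T' := by
    rw [hYdef]; ext x
    simp only [Finset.mem_compl, Finset.mem_erase, Finset.mem_insert, not_and, not_not]
    tauto
  -- validity: exactly the splits `s`, `s + 1`, `s + 2`
  have hvalid : ∀ c : Fin n, (((univ.filter fun c' : Fin n => (c' : ℕ) < c).image r).card = c ∧
      ((univ.filter fun c' : Fin n => (c : ℕ) < c').image r).card = n - 1 - c) ↔ (s ≤ (c : ℕ) ∧ (c : ℕ) < s + 3) := by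
    refine designWord_valid_iff Xs Y hXcard hYcard hsn mid r hr (by omega) ?_ ?_ ?_ ?_ ?_
    · intro i hi
      have hi' : i = 0 ∨ i = 1 := by
        rcases Nat.lt_or_ge (i : ℕ) 1 with h | h
        · exact Or.inl (Fin.ext (by simp only [Fin.val_zero]; omega))
        · exact Or.inr (Fin.ext (by simp only [Fin.val_one]; omega))
      rcases hi' with rfl | rfl
      · rw [hmid0]; exact h3t1
      · rw [hmid1]; exact hfX
    · intro i hi
      have hi' : i = 1 ∨ i = 2 := by
        rcases Nat.lt_or_ge (i : ℕ) 2 with h | h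
        · exact Or.inl (Fin.ext (by simp only [Fin.val_one]; omega))
        · exact Or.inr (Fin.ext (by have := i.isLt; simp only [Fin.val_two]; omega))
      rcases hi' with rfl | rfl
      · rw [hmid1, hYdef]
        exact fun h => (Finset.mem_compl.mp (Finset.mem_of_mem_erase h)) hy3
      · rw [hmid2, hYdef]; exact Finset.notMem_erase β _
    · intro i i' hii' h
      have hi3 := i'.isLt
      have key : ¬ ((i : ℕ) = 0 ∧ (i' : ℕ) = 1) ∧ ¬ ((i : ℕ) = 1 ∧ (i' : ℕ) = 2) := by
        constructor
        · rintro ⟨h0, h1⟩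
          have e0 : i = 0 := Fin.ext h0
          have e1 : i' = 1 := Fin.ext h1
          rw [e0, e1, hmid0, hmid1] at h; exact hαf h
        · rintro ⟨h1, h2⟩
          have e1 : i = 1 := Fin.ext h1
          have e2 : i' = 2 := Fin.ext h2
          rw [e1, e2, hmid1, hmid2] at h; exact hfβ h
      omega
    · by_cases hab : α = β
      · exact ⟨⟨s + 2, by omega⟩, by simp, by rw [hrs, hrs2, hab]⟩
      · have hαY : α ∈ Y := by
          rw [hYdef, Finset.mem_erase]; exact ⟨hab, Finset.mem_compl.mpr hαT'⟩
        obtain ⟨p, hp, hpr⟩ := designWord_mem_Y Xs Y hXcard hYcard hsn mid r hr hαY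
        exact ⟨p, by omega, by rw [hpr, hrs]⟩
    · by_cases hab : α = β
      · exact ⟨⟨s, by omega⟩, by simp only; omega, by
          have h1 : (⟨s + 3 - 1, by omega⟩ : Fin n) = ⟨s + 2, by omega⟩ := Fin.ext (by simp)
          rw [h1, hrs, hrs2, hab]⟩
      · have hβX : β ∈ Xs := by
          have : β ∈ insert α Xs := by rw [h3U]; exact hβS
          exact (Finset.mem_insert.mp this).resolve_left (Ne.symm hab)
        obtain ⟨p, hp, hpr⟩ := designWord_mem_X Xs Y hXcard hYcard hsn mid r hr hβX
        refine ⟨p, by omega, ?_⟩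
        have h1 : (⟨s + 3 - 1, by omega⟩ : Fin n) = ⟨s + 2, by omega⟩ := Fin.ext (by simp)
        rw [h1, hpr, hrs2]
  -- the window identity with the known indices
  have hwin := grenet_window_identity' e hn hN A' htr r
    (fun c => if (c : ℕ) = s then i₃ else if (c : ℕ) = s + 1 then i else i₄)
    (fun c => if (c : ℕ) = s then j₃ else if (c : ℕ) = s + 1 then j else j₄)
    (fun c h1 h2 => by
      obtain ⟨hc1, hc2⟩ := (hvalid c).mp ⟨h1, h2⟩
      by_cases hc : (c : ℕ) = s
      · rw [if_pos hc]
        have hfl : (univ.filter fun c' : Fin n => (c' : ℕ) < c) = univ.filter fun c' : Fin n => (c' : ℕ) < s :=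
          Finset.filter_congr fun c' _ => by rw [hc]
        rw [hfl, hpre0]
      · rw [if_neg hc]
        by_cases hc' : (c : ℕ) = s + 1
        · rw [if_pos hc']
          have hfl : (univ.filter fun c' : Fin n => (c' : ℕ) < c) = univ.filter fun c' : Fin n => (c' : ℕ) < s + 1 :=
            Finset.filter_congr fun c' _ => by rw [hc']
          rw [hfl, hpre1]
        · rw [if_neg hc']
          have hc'' : (c : ℕ) = s + 2 := by omega
          have hfl : (univ.filter fun c' : Fin n => (c' : ℕ) < c) = univ.filter fun c' : Fin n => (c' : ℕ) < s + 2 :=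
            Finset.filter_congr fun c' _ => by rw [hc'']
          rw [hfl, hpre2, h4U])
    (fun c h1 h2 => by
      obtain ⟨hc1, hc2⟩ := (hvalid c).mp ⟨h1, h2⟩
      by_cases hc : (c : ℕ) = s
      · rw [if_pos hc]
        have hfl : (univ.filter fun c' : Fin n => (c : ℕ) < c') = univ.filter fun c' : Fin n => s < (c' : ℕ) :=
          Finset.filter_congr fun c' _ => by rw [hc]
        rw [hfl, hsuf0, compl_compl, hCj₃]
      · rw [if_neg hc]
        by_cases hc' : (c : ℕ) = s + 1
        · rw [if_pos hc']
          have hfl : (univ.filter fun c' : Fin n => (c : ℕ) < c') = univ.filter fun c' : Fin n => s + 1 < (c' : ℕ) :=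
            Finset.filter_congr fun c' _ => by rw [hc']
          rw [hfl, hsuf1, compl_compl]
        · rw [if_neg hc']
          have hc'' : (c : ℕ) = s + 2 := by omega
          have hfl : (univ.filter fun c' : Fin n => (c : ℕ) < c') = univ.filter fun c' : Fin n => s + 2 < (c' : ℕ) :=
            Finset.filter_congr fun c' _ => by rw [hc'']
          rw [hfl, hsuf2, hYc, hCj₄])
  rw [Finset.filter_congr fun c _ => hvalid c] at hwin
  have htri : (univ.filter fun c : Fin n => s ≤ (c : ℕ) ∧ (c : ℕ) < s + 3)
      = {(⟨s, by omega⟩ : Fin n), ⟨s + 1, by omega⟩, ⟨s + 2, by omega⟩} := by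
    ext c
    simp only [Finset.mem_filter, Finset.mem_univ, true_and, Finset.mem_insert, Finset.mem_singleton,
      Fin.ext_iff]
    omega
  rw [htri, Finset.sum_insert (by simp [Fin.ext_iff]),
    Finset.sum_pair (fun h => by rw [Fin.ext_iff] at h; simp only at h; omega)] at hwin
  simp only [Nat.succ_ne_self, if_true, if_false, hrs, hrs1, hrs2, show s + 2 ≠ s by omega,
    show s + 2 ≠ s + 1 by omega] at hwin
  have hv : (f, (⟨s + 1, by omega⟩ : Fin n)) = v := Prod.ext rfl (Fin.ext hv2.symm)
  have hv₃ : (α, (⟨s, by omega⟩ : Fin n)) = v₃ := Prod.ext rfl (Fin.ext rfl)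
  have hv₄ : (β, (⟨s + 2, by omega⟩ : Fin n)) = v₄ := Prod.ext rfl (Fin.ext hv₄2.symm)
  rw [hv, hv₃, hv₄] at hwin
  linear_combination hwin

end BlockIeq



end Summit.ValiantsHypothesis.Theorems.RigidityForcesSymmetry.GrenetGauge
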